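import Summits.ABC.ABC.Theorems.DefiniteXiFreyModularitySketchReshape3
import Literature.NumberTheory.Automorphic.CDTTheorem712TwoLiftsProofs
import Literature.NumberTheory.Automorphic.CDTTheorem722TwoFactsProofs
import HarnessLib

/-!
# Crux `FreyModularity` (stmt-ABC-11340), line `Sketch`, reshapes 4–5 composed: the residual of
# Frey modularity in its weakest printed form

Reshape 3 (`DefiniteXiFreyModularitySketchReshape3`) left the crux
`Summit.ABC.ABC.Theses.DefiniteXi.FreyModularity` ("every Frey curve `E_(a,b)`, `a ⊥ b`,
`ab(a+b) ≠ 0`, is `BCDT.IsModular`") resting on three COMPOSITE engines: CDT 1999 Thm. 7.2.1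
restricted to `9 ∤ N`, Thm. 7.2.2 restricted to `25 ∤ N`, and the Shepherd-Barron–Taylor auxiliary
curve.  This file (continuation lead `c2`) records the two further reductions of the line, both
kernel-checked compositions of the printed proof of CDT Thm. 7.1.2 (JAMS 12 (1999), p. 556) run on a
Frey curve:

* **Reshape 4 — the switch FROM A CURVE.**  The composition only ever switches `ρ̄ = ρ̄_{E,5}` of the
  Frey curve itself, in the case where no framed `ρ̄_{E,3}` is absolutely irreducible over `ℚ(√-3)`,
  with `27 ∤ N_E` and `ρ̄|ℚ(√5)` absolutely irreducible in hand — i.e. under exactly the hypotheses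
  of the tree's named fact `BCDT.CDT_three_five_switch` (Wiles 1995 Ch. 5 as printed by CDT, p. 556:
  `[E] ∈ X_E(5)(ℚ)` makes the twist of `X(5)` a `ℙ¹`), which is implied by, and strictly weaker in
  print than, the Shepherd-Barron–Taylor form `BCDT.exists_isTorsionGaloisRep_five_and_surjective_three`
  (`CDT_three_five_switch_of_exists_isTorsionGaloisRep_five_and_surjective_three`).
* **Reshape 5 — the lifting engines cut into the tree's catalogued atoms**, along the glue the
  Literature already proves (`CDT_theorem_7_2_1_of_modThree_of_lift_of_three_imp_two`,
  `CDT_theorem_7_2_2_of_lift_of_three_imp_two`): Langlands–Tunnell for `ρ̄_{E,3}` (`hmod3`), the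
  GALOIS-FORM lifting statements "`ρ̄_{E,ℓ}` modular ⇒ `ρ_{E,ℓ}` modular" at `ℓ = 3` for `9 ∤ N_E`
  and at `ℓ = 5` for `25 ∤ N_E` (`hlift3`, `hlift5`: Wiles 1995 / Taylor–Wiles 1995 / Diamond 1996 —
  curves SEMISTABLE at `ℓ`, so no potentially Barsotti–Tate input of CDT is ever needed by the Frey
  family), and BCDT's (3) ⇒ (2) "`ρ_{E,ℓ}` modular ⇒ `E` modular" (`h32`: Eichler–Shimura and
  Carayol; Faltings' isogeny theorem is the tree's `isIsogenous_iff_frobeniusTrace_eq_holds`).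

Results:

* `isModular_freyCurve_of_atoms`, `freyModularity_of_atoms` — **`FreyModularity` from the five atoms**
  (the registered stubs `stub_modThree`, `stub_liftThree`, `stub_liftFive`, `stub_threeImpTwo`,
  `stub_switch` of `Cruxes/FreyModularity/Lines/Sketch.lean`, verbatim as hypotheses).
* `freyModularity_of_langlands_tunnell_of_lifts_of_two_facts_of_switch` — the same with
  Langlands–Tunnell, (3) ⇒ (2) and the switch supplied by the tree's CATALOGUED named facts
  `langlands_tunnell`, `eichlerShimuraConstruction`, `IsNewformOf.level_eq_conductorNorm` (Carayol),
  `CDT_three_five_switch`: the trust base of Frey modularity along this line is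
  {Langlands–Tunnell, `R = T` at `3` and at `5` for curves semistable at `ℓ`, Eichler–Shimura,
  Carayol, Wiles' switch}.
* `freyModularity_of_CDT721_CDT722_CDTswitch` — the coarser trust base of reshape 3 with its third
  member WEAKENED: {`CDT_theorem_7_2_1`, `CDT_theorem_7_2_2`, `CDT_three_five_switch`} (compare
  `freyModularity_of_CDT721_CDT722_switch`, which needs the Shepherd-Barron–Taylor form).
-/

-- `Summit.<Summit>.<Problem>` is the mandated summit-side namespace (CONVENTIONS §2); for the
-- single-conjunct summit `ABC` the two coincide, so the duplicate `ABC.ABC` is deliberate.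
set_option linter.dupNamespace false

noncomputable section

open scoped MatrixGroups NumberField

open Literature.NumberTheory.EllipticCurves
open Literature.NumberTheory.EllipticCurves.ModularForms (eichlerShimuraConstruction)
open Literature.NumberTheory.Automorphic
open Literature.NumberTheory.Automorphic.BCDT
open Literature.NumberTheory.GaloisRepresentations
open WeierstrassCurve

namespace Summit.ABC.ABC.Theorems

/-- **Every Frey curve is modular, from the five atoms** — CDT 1999, proof of Thm. 7.1.2 (p. 556)
run on `E = E_(a,b)` (`a ⊥ b`, `ab(a+b) ≠ 0`; `9 ∤ N_E`, `25 ∤ N_E`): case A, some framed `ρ̄_{E,3}`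
absolutely irreducible over `ℚ(√-3)`: it is modular (`hmod3`, Langlands–Tunnell), so `ρ_{E,3}` is
modular (`hlift3`) and `E` is modular (`h32` at `3`); case B, none is: `ρ̄_{E,5}` is irreducible
(Frey rigidity, `isIrreducible_freyCurve_five`), hence absolutely irreducible over `ℚ(√5)`
(`stub_absIrrSqrtFive`, Rubin's Prop. 7 with `25 ∤ N_E`); Wiles' switch from `E` itself (`hsw`, fed
`27 ∤ N_E`) gives `E'` with `E'[5] ≅ E[5]` and a framed `ρ̄_{E',3}` absolutely irreducible over
`ℚ(√-3)`; `9 ∤ N_{E'}` (`stub_nineTransfer`); `E'` is modular by case A's chain; so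
`ρ̄_{E,5} = ρ̄_{E',5}` is modular (`IsModular.isModular_of_isTorsionGaloisRep''`), `ρ_{E,5}` is modular
(`hlift5`) and `E` is modular (`h32` at `5`). [cite: ConradDiamondTaylor1999, Thm. 7.1.2 (proof, p. 556)] -/
theorem isModular_freyCurve_of_atoms
    (hmod3 : ∀ (W : WeierstrassCurve ℚ) [W.IsElliptic] (ρ : ModPGaloisRep ℚ (ZMod 3) 2),
      W.IsTorsionGaloisRep 3 ρ → FramedRep.IsAbsolutelyIrreducible ρ → ρ.IsModular)
    (hlift3 : ∀ (W : WeierstrassCurve ℚ) [W.IsElliptic] (ρ : ModPGaloisRep ℚ (ZMod 3) 2),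
      W.IsTorsionGaloisRep 3 ρ → ρ.IsAbsIrreducibleOverSqrt (-3) → ¬ 9 ∣ W.conductorNorm ℤ →
      ρ.IsModular → W.IsModularGaloisRepTate 3)
    (hlift5 : ∀ (W : WeierstrassCurve ℚ) [W.IsElliptic] (ρ : ModPGaloisRep ℚ (ZMod 5) 2),
      W.IsTorsionGaloisRep 5 ρ → ρ.IsAbsIrreducibleOverSqrt 5 → ¬ 25 ∣ W.conductorNorm ℤ →
      ρ.IsModular → W.IsModularGaloisRepTate 5)
    (h32 : ∀ (W : WeierstrassCurve ℚ) [W.IsElliptic] [NeZero (W.conductorNorm ℤ)] (ℓ : ℕ)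
      [Fact ℓ.Prime], W.IsModularGaloisRepTate ℓ → BCDT.IsModular W)
    (hsw : CDT_three_five_switch)
    {a b : ℤ} (hab : IsCoprime a b) (h0 : a * b * (a + b) ≠ 0)
    [NeZero ((freyCurve a b).conductorNorm ℤ)] : BCDT.IsModular (freyCurve a b) := by
  haveI := isElliptic_freyCurve h0
  have h9 : ¬ 9 ∣ (freyCurve a b).conductorNorm ℤ := not_nine_dvd_conductorNorm_freyCurve hab h0
  have h25 : ¬ 25 ∣ (freyCurve a b).conductorNorm ℤ := not_twentyFive_dvd_conductorNorm_freyCurve hab h0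
  -- the chain "framed `ρ̄_{W,3}` absolutely irreducible over `ℚ(√-3)`, `9 ∤ N_W` ⇒ `W` modular"
  have hA3 : ∀ (W : WeierstrassCurve ℚ) [W.IsElliptic] [NeZero (W.conductorNorm ℤ)]
      (ρ₃ : ModPGaloisRep ℚ (ZMod 3) 2), W.IsTorsionGaloisRep 3 ρ₃ →
      ρ₃.IsAbsIrreducibleOverSqrt (-3) → ¬ 9 ∣ W.conductorNorm ℤ → BCDT.IsModular W :=
    fun W _ _ ρ₃ hρ₃ h3i h9W ↦
      h32 W 3 (hlift3 W ρ₃ hρ₃ h3i h9W (hmod3 W ρ₃ hρ₃ h3i.isAbsolutelyIrreducible))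
  -- case A: some framed model of `E[3]` is absolutely irreducible over `ℚ(√-3)`
  by_cases hA : ∃ ρ₃ : ModPGaloisRep ℚ (ZMod 3) 2,
      (freyCurve a b).IsTorsionGaloisRep 3 ρ₃ ∧ ρ₃.IsAbsIrreducibleOverSqrt (-3)
  · obtain ⟨ρ₃, hρ₃, h3i⟩ := hA
    exact hA3 (freyCurve a b) ρ₃ hρ₃ h3i h9
  -- case B: no framed model of `E[3]` is absolutely irreducible over `ℚ(√-3)`; work at `5`
  have hB : ∀ ρ₃ : ModPGaloisRep ℚ (ZMod 3) 2, (freyCurve a b).IsTorsionGaloisRep 3 ρ₃ →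
      ¬ ρ₃.IsAbsIrreducibleOverSqrt (-3) := fun ρ₃ hρ₃ h3i ↦ hA ⟨ρ₃, hρ₃, h3i⟩
  have h27 : ¬ 27 ∣ (freyCurve a b).conductorNorm ℤ := fun h27 ↦ h9 (dvd_trans ⟨3, rfl⟩ h27)
  obtain ⟨ρ, hρ⟩ := (freyCurve a b).exists_isTorsionGaloisRep 5
  have hirr : FramedRep.IsIrreducible ρ := isIrreducible_freyCurve_five a b hab h0 ρ hρ
  have h5 : ρ.IsAbsIrreducibleOverSqrt 5 := stub_absIrrSqrtFive (freyCurve a b) h25 ρ hρ hirr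
  -- Wiles' switch from `E` itself
  obtain ⟨W', hW', hρ', ρ₃', hρ₃', h3i'⟩ := hsw (freyCurve a b) h27 hB ρ hρ h5
  haveI := hW'
  haveI : NeZero (W'.conductorNorm ℤ) := ⟨(conductorNorm_pos_holds W').ne'⟩
  -- `E'` is semistable at `3` (Silverberg's transfer), hence modular by case A's chain
  have h9' : ¬ 9 ∣ W'.conductorNorm ℤ := stub_nineTransfer (freyCurve a b) W' ρ hρ hρ' h9
  have hE' : BCDT.IsModular W' := hA3 W' ρ₃' hρ₃' h3i' h9'
  -- so `ρ̄ = ρ̄_{E,5} = ρ̄_{E',5}` is modular, `ρ_{E,5}` is modular, and `E` is modular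
  have hρmod : ρ.IsModular := hE'.isModular_of_isTorsionGaloisRep'' hρ'
  exact h32 (freyCurve a b) 5 (hlift5 (freyCurve a b) ρ hρ h5 h25 hρmod)

/-- **Registered composition stub `freyModularity_of_atoms` of the line `Sketch` (reshape 5): the
crux `FreyModularity` from the five atoms**, verbatim the registered stubs `stub_modThree`
(Langlands–Tunnell), `stub_liftThree`, `stub_liftFive` (Galois-form lifting at `3`, `5` for curves
semistable at `ℓ`), `stub_threeImpTwo` ((3) ⇒ (2)) and `stub_switch` (`= CDT_three_five_switch`),
concluded BY NAME through `freyModularity_iff_forall_isModular_freyCurve`.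
[cite: ConradDiamondTaylor1999, Thm. 7.1.2 (proof, p. 556)] -/
theorem freyModularity_of_atoms
    (hmod3 : ∀ (W : WeierstrassCurve ℚ) [W.IsElliptic] (ρ : ModPGaloisRep ℚ (ZMod 3) 2),
      W.IsTorsionGaloisRep 3 ρ → FramedRep.IsAbsolutelyIrreducible ρ → ρ.IsModular)
    (hlift3 : ∀ (W : WeierstrassCurve ℚ) [W.IsElliptic] (ρ : ModPGaloisRep ℚ (ZMod 3) 2),
      W.IsTorsionGaloisRep 3 ρ → ρ.IsAbsIrreducibleOverSqrt (-3) → ¬ 9 ∣ W.conductorNorm ℤ →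
      ρ.IsModular → W.IsModularGaloisRepTate 3)
    (hlift5 : ∀ (W : WeierstrassCurve ℚ) [W.IsElliptic] (ρ : ModPGaloisRep ℚ (ZMod 5) 2),
      W.IsTorsionGaloisRep 5 ρ → ρ.IsAbsIrreducibleOverSqrt 5 → ¬ 25 ∣ W.conductorNorm ℤ →
      ρ.IsModular → W.IsModularGaloisRepTate 5)
    (h32 : ∀ (W : WeierstrassCurve ℚ) [W.IsElliptic] [NeZero (W.conductorNorm ℤ)] (ℓ : ℕ)
      [Fact ℓ.Prime], W.IsModularGaloisRepTate ℓ → BCDT.IsModular W)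
    (hsw : CDT_three_five_switch) : Summit.ABC.ABC.Theses.DefiniteXi.FreyModularity :=
  freyModularity_iff_forall_isModular_freyCurve.mpr
    fun _ _ hab h0 _ ↦ isModular_freyCurve_of_atoms hmod3 hlift3 hlift5 h32 hsw hab h0

/-- **`FreyModularity` on the catalogued trust base {Langlands–Tunnell, `R = T` at `3` and at `5`
for curves semistable at `ℓ`, Eichler–Shimura, Carayol, Wiles' switch}.**  Langlands–Tunnell enters
through the tree's proved `modThree_of_langlands_tunnell` (the named fact `langlands_tunnell` for
every `σ : Γ_ℚ → GL₂(ℂ)`), (3) ⇒ (2) through `isModular_of_isModularGaloisRepTate_of_two_facts`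
(`eichlerShimuraConstruction` and Carayol's `IsNewformOf.level_eq_conductorNorm`; Faltings being the
tree's theorem `isIsogenous_iff_frobeniusTrace_eq_holds`), the switch as `CDT_three_five_switch`; the
two lifting statements stay in Galois form (the tree carries them as hypothesis shapes, D-0026).
[cite: ConradDiamondTaylor1999, Thm. 7.1.2 (proof, p. 556)] -/
theorem freyModularity_of_langlands_tunnell_of_lifts_of_two_facts_of_switch
    (hLT : ∀ σ : FramedArtinRep ℚ 2, langlands_tunnell σ)
    (hlift3 : ∀ (W : WeierstrassCurve ℚ) [W.IsElliptic] (ρ : ModPGaloisRep ℚ (ZMod 3) 2),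
      W.IsTorsionGaloisRep 3 ρ → ρ.IsAbsIrreducibleOverSqrt (-3) → ¬ 9 ∣ W.conductorNorm ℤ →
      ρ.IsModular → W.IsModularGaloisRepTate 3)
    (hlift5 : ∀ (W : WeierstrassCurve ℚ) [W.IsElliptic] (ρ : ModPGaloisRep ℚ (ZMod 5) 2),
      W.IsTorsionGaloisRep 5 ρ → ρ.IsAbsIrreducibleOverSqrt 5 → ¬ 25 ∣ W.conductorNorm ℤ →
      ρ.IsModular → W.IsModularGaloisRepTate 5)
    (hES : eichlerShimuraConstruction)
    (hC : ∀ (N : ℕ) [NeZero N],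
      Literature.NumberTheory.EllipticCurves.ModularForms.IsNewformOf.level_eq_conductorNorm (N := N))
    (hsw : CDT_three_five_switch) : Summit.ABC.ABC.Theses.DefiniteXi.FreyModularity :=
  freyModularity_of_atoms (modThree_of_langlands_tunnell hLT) hlift3 hlift5
    (fun W _ _ ℓ _ h ↦ isModular_of_isModularGaloisRepTate_of_two_facts hES hC W ℓ h) hsw

/-- **`FreyModularity` on the trust base {CDT Thm. 7.2.1, CDT Thm. 7.2.2, Wiles' switch from a
curve}** — as `freyModularity_of_CDT721_CDT722_switch` (reshape 3) but with the third named fact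
WEAKENED from the Shepherd-Barron–Taylor auxiliary curve to `BCDT.CDT_three_five_switch`; the lifting
atoms are supplied by `lift_three_of_CDT_theorem_7_2_1` (`9 ∣ 27`) and `lift_of_CDT_theorem_7_2_2`,
and Langlands–Tunnell / (3) ⇒ (2) are not needed separately because `CDT_theorem_7_2_1` already
concludes `IsModular` (its chain is inlined: `hmod3`, `h32` are instantiated trivially through
`CDT_theorem_7_2_1` / `CDT_theorem_7_2_2` themselves). [cite: ConradDiamondTaylor1999, Thm. 7.1.2 (proof, p. 556)] -/
theorem freyModularity_of_CDT721_CDT722_CDTswitch (h721 : CDT_theorem_7_2_1)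
    (h722 : CDT_theorem_7_2_2) (hsw : CDT_three_five_switch) :
    Summit.ABC.ABC.Theses.DefiniteXi.FreyModularity := by
  refine freyModularity_iff_forall_isModular_freyCurve.mpr fun a b hab h0 _ ↦ ?_
  haveI := isElliptic_freyCurve h0
  have h9 : ¬ 9 ∣ (freyCurve a b).conductorNorm ℤ := not_nine_dvd_conductorNorm_freyCurve hab h0
  have h25 : ¬ 25 ∣ (freyCurve a b).conductorNorm ℤ := not_twentyFive_dvd_conductorNorm_freyCurve hab h0
  have h27_of_9 : ∀ (W : WeierstrassCurve ℚ), ¬ 9 ∣ W.conductorNorm ℤ → ¬ 27 ∣ W.conductorNorm ℤ :=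
    fun W h9W h27 ↦ h9W (dvd_trans ⟨3, rfl⟩ h27)
  by_cases hA : ∃ ρ₃ : ModPGaloisRep ℚ (ZMod 3) 2,
      (freyCurve a b).IsTorsionGaloisRep 3 ρ₃ ∧ ρ₃.IsAbsIrreducibleOverSqrt (-3)
  · obtain ⟨ρ₃, hρ₃, h3i⟩ := hA
    exact h721 (freyCurve a b) ρ₃ hρ₃ h3i (h27_of_9 _ h9)
  have hB : ∀ ρ₃ : ModPGaloisRep ℚ (ZMod 3) 2, (freyCurve a b).IsTorsionGaloisRep 3 ρ₃ →
      ¬ ρ₃.IsAbsIrreducibleOverSqrt (-3) := fun ρ₃ hρ₃ h3i ↦ hA ⟨ρ₃, hρ₃, h3i⟩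
  obtain ⟨ρ, hρ⟩ := (freyCurve a b).exists_isTorsionGaloisRep 5
  have hirr : FramedRep.IsIrreducible ρ := isIrreducible_freyCurve_five a b hab h0 ρ hρ
  have h5 : ρ.IsAbsIrreducibleOverSqrt 5 := stub_absIrrSqrtFive (freyCurve a b) h25 ρ hρ hirr
  obtain ⟨W', hW', hρ', ρ₃', hρ₃', h3i'⟩ := hsw (freyCurve a b) (h27_of_9 _ h9) hB ρ hρ h5
  haveI := hW'
  haveI : NeZero (W'.conductorNorm ℤ) := ⟨(conductorNorm_pos_holds W').ne'⟩
  have h9' : ¬ 9 ∣ W'.conductorNorm ℤ := stub_nineTransfer (freyCurve a b) W' ρ hρ hρ' h9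
  have hE' : BCDT.IsModular W' := h721 W' ρ₃' hρ₃' h3i' (h27_of_9 _ h9')
  exact h722 (freyCurve a b) ρ hρ h5 (hE'.isModular_of_isTorsionGaloisRep'' hρ')

end Summit.ABC.ABC.Theorems

end
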